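import Summits.MatrixMultiplication.OmegaCensus.Z4Z4Characters
import Summits.MatrixMultiplication.OmegaCensus.CubeSymmetricForm
import HarnessLib

/-!
# Gaussian-integer tables for the three-set cube shape `(3,3 | 3,3 | e,e)` over `A ↠ ℤ₄ × ℤ₄`

ω-census `pub-omega`, family (b3), seat pub-omega-group gen 14.  Framing: lottery ticket; floor = certified bounds/negative
ranges.  VALUE: the decidable core of `CubePartThreeZ4Z4.lean`; NOT progress on ω.

For a cube law triple `(c,c | d,d | e,e)` the tree's structure theorem (`cube_structure_of_law_any`) and the vertex-`000` packing
give `(κ₁ + (−W + X + Y)) ⊔ (κ₂ + (W − X + Y)) ⊔ (κ₃ + (W + X − Y)) = A ∖ {x₀}` with `W = S₀`, `X = T₀`, `Y = U₀`.  For a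
character `ψ` pulled back from `Q = ℤ₄²` this gives, with `c = ψ(W)`, `a = ψ(X)`, `b = ψ(Y)`,
`(E_ψ)  ψ(κ₁) c̄ a b + ψ(κ₂) c ā b + ψ(κ₃) c a b̄ = −ψ(x₀)` (`cube_form_charsum`).  When `|W| = |X| = 3` and `W` is put in the
coordinates of `exists_dual_pair` (`c = ξ(2+i)` resp. `ξ(1+2i)`), `a = η(1 + i^{m₂} + i^{m₃})`, and after multiplying by `ξ̄η̄`,
`(E_ψ)` takes the normal form of the tables below (`J₁ = j₁ + 2s`, `J₂ = j₂ + 2t` with `ξ = i^s`, `η = i^t`).  The tables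
(`table33_two_add_i`, `table33_one_add_two_i`) say: unless `(m₂, m₃, J₂ − J₁)` is exceptional, `norm N < norm Det`, forcing
`b = 0`; `combine33` says the three characters `w, w', w+w'` cannot all be exceptional when `X` is in general position and
`κ̄₁ ≠ κ̄₂`.  Exceptional sets computed exactly offline (seat script `code/gen33.py`) and verified here by `decide`.  Also here:
`cube_form_charsum` (the character form of the three-set near-factorisation) and `cube_shifted_form_of_law` (the
three-set shifted form itself, from `cube_structure_of_law_any` and the vertex-`000` packing, any parity, any `c₀`).
-/

namespace Summit.MatrixMultiplication.OmegaCensus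

open Literature.Combinatorics.Additive Finset

/-! ## Small facts -/

/-- `i^m · conj(i^m) = 1`. [folklore] -/
theorem ipow_mul_star (m : ZMod 4) :
    (⟨0, 1⟩ : GaussianInt) ^ m.val * star ((⟨0, 1⟩ : GaussianInt) ^ m.val) = 1 := by
  revert m; decide

/-- A real character value is `±1`: `i^(2s) = 1 ∨ i^(2s) = −1`. [folklore] -/
theorem ipow_two_mul_cases (s : ZMod 4) :
    (⟨0, 1⟩ : GaussianInt) ^ (2 * s).val = 1 ∨ (⟨0, 1⟩ : GaussianInt) ^ (2 * s).val = -1 := by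
  revert s; decide

/-- `i^(2s) = (i^s)²` as `i^s · i^s`. [folklore] -/
theorem ipow_two_mul_eq_sq (s : ZMod 4) :
    (⟨0, 1⟩ : GaussianInt) ^ (2 * s).val = (⟨0, 1⟩ : GaussianInt) ^ s.val * (⟨0, 1⟩ : GaussianInt) ^ s.val := by
  rw [two_mul, ipow_add]

/-- Norm comparison: `D · b = N` with `norm N < norm D` forces `b = 0`. [folklore] -/
theorem eq_zero_of_norm_lt {D N b : GaussianInt} (h : D * b = N) (hlt : N.norm < D.norm) : b = 0 := by
  by_contra hb
  have hb1 : 1 ≤ b.norm := by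
    have h0 : 0 ≤ b.norm := Zsqrtd.norm_nonneg (by norm_num) b
    have hne : b.norm ≠ 0 := fun h' => hb ((Zsqrtd.norm_eq_zero_iff (by norm_num) b).1 h')
    omega
  have hD : 0 ≤ D.norm := Zsqrtd.norm_nonneg (by norm_num) D
  have := Zsqrtd.norm_mul D b
  rw [h] at this
  nlinarith

/-- Exponent bookkeeping in `ZMod 4`: `2((j₂ − 2t) − (j₁ − 2s)) = 2j₂ − 2j₁`. [folklore] -/
theorem zmod4_two_mul_K (j₁ j₂ s t : ZMod 4) :
    2 * ((j₂ + -t + -t) - (j₁ + -s + -s)) = 2 * j₂ - 2 * j₁ := by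
  revert j₁ j₂ s t; decide

/-- In `ℤ[i]`, `x = −x` forces `x = 0`. [folklore] -/
theorem gaussInt_eq_zero_of_eq_neg {x : GaussianInt} (h : x = -x) : x = 0 := by
  have hre : x.re = -x.re := by have := congrArg Zsqrtd.re h; simpa using this
  have him : x.im = -x.im := by have := congrArg Zsqrtd.im h; simpa using this
  ext <;> simp <;> omega

/-! ## The tables -/

set_option synthInstance.maxSize 8192 in
set_option synthInstance.maxHeartbeats 400000 in
/-- **Three-set table, `c = 2 + i`** (`decide`, `4096` cases).  With `α = 1 + i^{m₂} + i^{m₃}`, `p = i^{J₁} c̄ α + i^{J₂} c ᾱ`,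
`q = i^{j₃} c α`, `r = −i^l`: either `norm(p̄ r − q r̄) < norm(p̄ p − q q̄)` (then `b = 0` in `Det · b = N`), or
`(m₂, m₃, J₂ − J₁)` lies in the explicit exceptional set `REL₁` (22 triples). [folklore] -/
theorem table33_two_add_i : ∀ m₂ m₃ J₁ J₂ j₃ l : ZMod 4,
    (star ((⟨0, 1⟩ : GaussianInt) ^ J₁.val * star (⟨2, 1⟩ : GaussianInt) * (1 + (⟨0, 1⟩ : GaussianInt) ^ m₂.val + (⟨0, 1⟩ : GaussianInt) ^ m₃.val) + (⟨0, 1⟩ : GaussianInt) ^ J₂.val * (⟨2, 1⟩ : GaussianInt) * star (1 + (⟨0, 1⟩ : GaussianInt) ^ m₂.val + (⟨0, 1⟩ : GaussianInt) ^ m₃.val)) *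
          (-(⟨0, 1⟩ : GaussianInt) ^ l.val) - ((⟨0, 1⟩ : GaussianInt) ^ j₃.val * (⟨2, 1⟩ : GaussianInt) * (1 + (⟨0, 1⟩ : GaussianInt) ^ m₂.val + (⟨0, 1⟩ : GaussianInt) ^ m₃.val)) * star (-(⟨0, 1⟩ : GaussianInt) ^ l.val)).norm <
      (star ((⟨0, 1⟩ : GaussianInt) ^ J₁.val * star (⟨2, 1⟩ : GaussianInt) * (1 + (⟨0, 1⟩ : GaussianInt) ^ m₂.val + (⟨0, 1⟩ : GaussianInt) ^ m₃.val) + (⟨0, 1⟩ : GaussianInt) ^ J₂.val * (⟨2, 1⟩ : GaussianInt) * star (1 + (⟨0, 1⟩ : GaussianInt) ^ m₂.val + (⟨0, 1⟩ : GaussianInt) ^ m₃.val)) *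
          ((⟨0, 1⟩ : GaussianInt) ^ J₁.val * star (⟨2, 1⟩ : GaussianInt) * (1 + (⟨0, 1⟩ : GaussianInt) ^ m₂.val + (⟨0, 1⟩ : GaussianInt) ^ m₃.val) + (⟨0, 1⟩ : GaussianInt) ^ J₂.val * (⟨2, 1⟩ : GaussianInt) * star (1 + (⟨0, 1⟩ : GaussianInt) ^ m₂.val + (⟨0, 1⟩ : GaussianInt) ^ m₃.val)) -
        ((⟨0, 1⟩ : GaussianInt) ^ j₃.val * (⟨2, 1⟩ : GaussianInt) * (1 + (⟨0, 1⟩ : GaussianInt) ^ m₂.val + (⟨0, 1⟩ : GaussianInt) ^ m₃.val)) * star ((⟨0, 1⟩ : GaussianInt) ^ j₃.val * (⟨2, 1⟩ : GaussianInt) * (1 + (⟨0, 1⟩ : GaussianInt) ^ m₂.val + (⟨0, 1⟩ : GaussianInt) ^ m₃.val))).norm ∨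
      ((m₂ = 0 ∧ m₃ = 0 ∧ J₂ - J₁ = 2) ∨
      (m₂ = 0 ∧ m₃ = 2 ∧ J₂ - J₁ = 1) ∨
      (m₂ = 0 ∧ m₃ = 2 ∧ J₂ - J₁ = 2) ∨
      (m₂ = 0 ∧ m₃ = 3 ∧ J₂ - J₁ = 0) ∨
      (m₂ = 1 ∧ m₃ = 1 ∧ J₂ - J₁ = 2) ∨
      (m₂ = 1 ∧ m₃ = 2 ∧ J₂ - J₁ = 0) ∨
      (m₂ = 1 ∧ m₃ = 2 ∧ J₂ - J₁ = 3) ∨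
      (m₂ = 1 ∧ m₃ = 3 ∧ J₂ - J₁ = 1) ∨
      (m₂ = 1 ∧ m₃ = 3 ∧ J₂ - J₁ = 2) ∨
      (m₂ = 2 ∧ m₃ = 0 ∧ J₂ - J₁ = 1) ∨
      (m₂ = 2 ∧ m₃ = 0 ∧ J₂ - J₁ = 2) ∨
      (m₂ = 2 ∧ m₃ = 1 ∧ J₂ - J₁ = 0) ∨
      (m₂ = 2 ∧ m₃ = 1 ∧ J₂ - J₁ = 3) ∨
      (m₂ = 2 ∧ m₃ = 2 ∧ J₂ - J₁ = 1) ∨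
      (m₂ = 2 ∧ m₃ = 2 ∧ J₂ - J₁ = 2) ∨
      (m₂ = 2 ∧ m₃ = 3 ∧ J₂ - J₁ = 0) ∨
      (m₂ = 2 ∧ m₃ = 3 ∧ J₂ - J₁ = 3) ∨
      (m₂ = 3 ∧ m₃ = 0 ∧ J₂ - J₁ = 0) ∨
      (m₂ = 3 ∧ m₃ = 1 ∧ J₂ - J₁ = 1) ∨
      (m₂ = 3 ∧ m₃ = 1 ∧ J₂ - J₁ = 2) ∨
      (m₂ = 3 ∧ m₃ = 2 ∧ J₂ - J₁ = 0) ∨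
      (m₂ = 3 ∧ m₃ = 2 ∧ J₂ - J₁ = 3)) := by
  decide

set_option synthInstance.maxSize 8192 in
set_option synthInstance.maxHeartbeats 400000 in
/-- **Three-set table, `c = 1 + 2i`** (`decide`, `4096` cases): the same with the exceptional set `REL₂`. [folklore] -/
theorem table33_one_add_two_i : ∀ m₂ m₃ J₁ J₂ j₃ l : ZMod 4,
    (star ((⟨0, 1⟩ : GaussianInt) ^ J₁.val * star (⟨1, 2⟩ : GaussianInt) * (1 + (⟨0, 1⟩ : GaussianInt) ^ m₂.val + (⟨0, 1⟩ : GaussianInt) ^ m₃.val) + (⟨0, 1⟩ : GaussianInt) ^ J₂.val * (⟨1, 2⟩ : GaussianInt) * star (1 + (⟨0, 1⟩ : GaussianInt) ^ m₂.val + (⟨0, 1⟩ : GaussianInt) ^ m₃.val)) *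
          (-(⟨0, 1⟩ : GaussianInt) ^ l.val) - ((⟨0, 1⟩ : GaussianInt) ^ j₃.val * (⟨1, 2⟩ : GaussianInt) * (1 + (⟨0, 1⟩ : GaussianInt) ^ m₂.val + (⟨0, 1⟩ : GaussianInt) ^ m₃.val)) * star (-(⟨0, 1⟩ : GaussianInt) ^ l.val)).norm <
      (star ((⟨0, 1⟩ : GaussianInt) ^ J₁.val * star (⟨1, 2⟩ : GaussianInt) * (1 + (⟨0, 1⟩ : GaussianInt) ^ m₂.val + (⟨0, 1⟩ : GaussianInt) ^ m₃.val) + (⟨0, 1⟩ : GaussianInt) ^ J₂.val * (⟨1, 2⟩ : GaussianInt) * star (1 + (⟨0, 1⟩ : GaussianInt) ^ m₂.val + (⟨0, 1⟩ : GaussianInt) ^ m₃.val)) *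
          ((⟨0, 1⟩ : GaussianInt) ^ J₁.val * star (⟨1, 2⟩ : GaussianInt) * (1 + (⟨0, 1⟩ : GaussianInt) ^ m₂.val + (⟨0, 1⟩ : GaussianInt) ^ m₃.val) + (⟨0, 1⟩ : GaussianInt) ^ J₂.val * (⟨1, 2⟩ : GaussianInt) * star (1 + (⟨0, 1⟩ : GaussianInt) ^ m₂.val + (⟨0, 1⟩ : GaussianInt) ^ m₃.val)) -
        ((⟨0, 1⟩ : GaussianInt) ^ j₃.val * (⟨1, 2⟩ : GaussianInt) * (1 + (⟨0, 1⟩ : GaussianInt) ^ m₂.val + (⟨0, 1⟩ : GaussianInt) ^ m₃.val)) * star ((⟨0, 1⟩ : GaussianInt) ^ j₃.val * (⟨1, 2⟩ : GaussianInt) * (1 + (⟨0, 1⟩ : GaussianInt) ^ m₂.val + (⟨0, 1⟩ : GaussianInt) ^ m₃.val))).norm ∨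
      ((m₂ = 0 ∧ m₃ = 0 ∧ J₂ - J₁ = 0) ∨
      (m₂ = 0 ∧ m₃ = 1 ∧ J₂ - J₁ = 2) ∨
      (m₂ = 0 ∧ m₃ = 2 ∧ J₂ - J₁ = 0) ∨
      (m₂ = 0 ∧ m₃ = 2 ∧ J₂ - J₁ = 1) ∨
      (m₂ = 1 ∧ m₃ = 0 ∧ J₂ - J₁ = 2) ∨
      (m₂ = 1 ∧ m₃ = 2 ∧ J₂ - J₁ = 2) ∨
      (m₂ = 1 ∧ m₃ = 2 ∧ J₂ - J₁ = 3) ∨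
      (m₂ = 1 ∧ m₃ = 3 ∧ J₂ - J₁ = 0) ∨
      (m₂ = 1 ∧ m₃ = 3 ∧ J₂ - J₁ = 1) ∨
      (m₂ = 2 ∧ m₃ = 0 ∧ J₂ - J₁ = 0) ∨
      (m₂ = 2 ∧ m₃ = 0 ∧ J₂ - J₁ = 1) ∨
      (m₂ = 2 ∧ m₃ = 1 ∧ J₂ - J₁ = 2) ∨
      (m₂ = 2 ∧ m₃ = 1 ∧ J₂ - J₁ = 3) ∨
      (m₂ = 2 ∧ m₃ = 2 ∧ J₂ - J₁ = 0) ∨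
      (m₂ = 2 ∧ m₃ = 2 ∧ J₂ - J₁ = 1) ∨
      (m₂ = 2 ∧ m₃ = 3 ∧ J₂ - J₁ = 2) ∨
      (m₂ = 2 ∧ m₃ = 3 ∧ J₂ - J₁ = 3) ∨
      (m₂ = 3 ∧ m₃ = 1 ∧ J₂ - J₁ = 0) ∨
      (m₂ = 3 ∧ m₃ = 1 ∧ J₂ - J₁ = 1) ∨
      (m₂ = 3 ∧ m₃ = 2 ∧ J₂ - J₁ = 2) ∨
      (m₂ = 3 ∧ m₃ = 2 ∧ J₂ - J₁ = 3) ∨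
      (m₂ = 3 ∧ m₃ = 3 ∧ J₂ - J₁ = 0)) := by
  decide

set_option synthInstance.maxSize 8192 in
set_option synthInstance.maxHeartbeats 400000 in
/-- **Combination of the three exceptional sets** (`decide`, `4096` cases): if `X` is in general position
(`(m̄₂, m̄₃)`, `(n̄₂, n̄₃)` and their sum non-zero mod `2`) and `κ̄₁ ≠ κ̄₂` (`K, K'` not both even), the three characters
`w, w', w + w'` cannot all be exceptional. [folklore] -/
theorem combine33 : ∀ m₂ m₃ n₂ n₃ K K' : ZMod 4,
    ¬ (2 * m₂ = 0 ∧ 2 * m₃ = 0) → ¬ (2 * n₂ = 0 ∧ 2 * n₃ = 0) → ¬ (2 * (m₂ + n₂) = 0 ∧ 2 * (m₃ + n₃) = 0) →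
    ¬ (2 * K = 0 ∧ 2 * K' = 0) →
    ¬ (((m₂ = 0 ∧ m₃ = 0 ∧ K = 2) ∨
      (m₂ = 0 ∧ m₃ = 2 ∧ K = 1) ∨
      (m₂ = 0 ∧ m₃ = 2 ∧ K = 2) ∨
      (m₂ = 0 ∧ m₃ = 3 ∧ K = 0) ∨
      (m₂ = 1 ∧ m₃ = 1 ∧ K = 2) ∨
      (m₂ = 1 ∧ m₃ = 2 ∧ K = 0) ∨
      (m₂ = 1 ∧ m₃ = 2 ∧ K = 3) ∨
      (m₂ = 1 ∧ m₃ = 3 ∧ K = 1) ∨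
      (m₂ = 1 ∧ m₃ = 3 ∧ K = 2) ∨
      (m₂ = 2 ∧ m₃ = 0 ∧ K = 1) ∨
      (m₂ = 2 ∧ m₃ = 0 ∧ K = 2) ∨
      (m₂ = 2 ∧ m₃ = 1 ∧ K = 0) ∨
      (m₂ = 2 ∧ m₃ = 1 ∧ K = 3) ∨
      (m₂ = 2 ∧ m₃ = 2 ∧ K = 1) ∨
      (m₂ = 2 ∧ m₃ = 2 ∧ K = 2) ∨
      (m₂ = 2 ∧ m₃ = 3 ∧ K = 0) ∨
      (m₂ = 2 ∧ m₃ = 3 ∧ K = 3) ∨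
      (m₂ = 3 ∧ m₃ = 0 ∧ K = 0) ∨
      (m₂ = 3 ∧ m₃ = 1 ∧ K = 1) ∨
      (m₂ = 3 ∧ m₃ = 1 ∧ K = 2) ∨
      (m₂ = 3 ∧ m₃ = 2 ∧ K = 0) ∨
      (m₂ = 3 ∧ m₃ = 2 ∧ K = 3)) ∧
       ((n₂ = 0 ∧ n₃ = 0 ∧ K' = 2) ∨
      (n₂ = 0 ∧ n₃ = 2 ∧ K' = 1) ∨
      (n₂ = 0 ∧ n₃ = 2 ∧ K' = 2) ∨
      (n₂ = 0 ∧ n₃ = 3 ∧ K' = 0) ∨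
      (n₂ = 1 ∧ n₃ = 1 ∧ K' = 2) ∨
      (n₂ = 1 ∧ n₃ = 2 ∧ K' = 0) ∨
      (n₂ = 1 ∧ n₃ = 2 ∧ K' = 3) ∨
      (n₂ = 1 ∧ n₃ = 3 ∧ K' = 1) ∨
      (n₂ = 1 ∧ n₃ = 3 ∧ K' = 2) ∨
      (n₂ = 2 ∧ n₃ = 0 ∧ K' = 1) ∨
      (n₂ = 2 ∧ n₃ = 0 ∧ K' = 2) ∨
      (n₂ = 2 ∧ n₃ = 1 ∧ K' = 0) ∨
      (n₂ = 2 ∧ n₃ = 1 ∧ K' = 3) ∨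
      (n₂ = 2 ∧ n₃ = 2 ∧ K' = 1) ∨
      (n₂ = 2 ∧ n₃ = 2 ∧ K' = 2) ∨
      (n₂ = 2 ∧ n₃ = 3 ∧ K' = 0) ∨
      (n₂ = 2 ∧ n₃ = 3 ∧ K' = 3) ∨
      (n₂ = 3 ∧ n₃ = 0 ∧ K' = 0) ∨
      (n₂ = 3 ∧ n₃ = 1 ∧ K' = 1) ∨
      (n₂ = 3 ∧ n₃ = 1 ∧ K' = 2) ∨
      (n₂ = 3 ∧ n₃ = 2 ∧ K' = 0) ∨
      (n₂ = 3 ∧ n₃ = 2 ∧ K' = 3)) ∧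
       (((m₂ + n₂) = 0 ∧ (m₃ + n₃) = 0 ∧ (K + K') = 0) ∨
      ((m₂ + n₂) = 0 ∧ (m₃ + n₃) = 1 ∧ (K + K') = 2) ∨
      ((m₂ + n₂) = 0 ∧ (m₃ + n₃) = 2 ∧ (K + K') = 0) ∨
      ((m₂ + n₂) = 0 ∧ (m₃ + n₃) = 2 ∧ (K + K') = 1) ∨
      ((m₂ + n₂) = 1 ∧ (m₃ + n₃) = 0 ∧ (K + K') = 2) ∨
      ((m₂ + n₂) = 1 ∧ (m₃ + n₃) = 2 ∧ (K + K') = 2) ∨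
      ((m₂ + n₂) = 1 ∧ (m₃ + n₃) = 2 ∧ (K + K') = 3) ∨
      ((m₂ + n₂) = 1 ∧ (m₃ + n₃) = 3 ∧ (K + K') = 0) ∨
      ((m₂ + n₂) = 1 ∧ (m₃ + n₃) = 3 ∧ (K + K') = 1) ∨
      ((m₂ + n₂) = 2 ∧ (m₃ + n₃) = 0 ∧ (K + K') = 0) ∨
      ((m₂ + n₂) = 2 ∧ (m₃ + n₃) = 0 ∧ (K + K') = 1) ∨
      ((m₂ + n₂) = 2 ∧ (m₃ + n₃) = 1 ∧ (K + K') = 2) ∨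
      ((m₂ + n₂) = 2 ∧ (m₃ + n₃) = 1 ∧ (K + K') = 3) ∨
      ((m₂ + n₂) = 2 ∧ (m₃ + n₃) = 2 ∧ (K + K') = 0) ∨
      ((m₂ + n₂) = 2 ∧ (m₃ + n₃) = 2 ∧ (K + K') = 1) ∨
      ((m₂ + n₂) = 2 ∧ (m₃ + n₃) = 3 ∧ (K + K') = 2) ∨
      ((m₂ + n₂) = 2 ∧ (m₃ + n₃) = 3 ∧ (K + K') = 3) ∨
      ((m₂ + n₂) = 3 ∧ (m₃ + n₃) = 1 ∧ (K + K') = 0) ∨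
      ((m₂ + n₂) = 3 ∧ (m₃ + n₃) = 1 ∧ (K + K') = 1) ∨
      ((m₂ + n₂) = 3 ∧ (m₃ + n₃) = 2 ∧ (K + K') = 2) ∨
      ((m₂ + n₂) = 3 ∧ (m₃ + n₃) = 2 ∧ (K + K') = 3) ∨
      ((m₂ + n₂) = 3 ∧ (m₃ + n₃) = 3 ∧ (K + K') = 0))) := by
  decide

/-! ## The character-sum identity of the three-set form -/

section CharSum

variable {A : Type*} [AddCommGroup A] [Fintype A] [DecidableEq A]

/-- **Character form of the three-set near-factorisation.**  For a multiplicative `χ : A → R` and three boxes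
`(κ₁ − W) + X + Y`, `W + (κ₂ − X) + Y`, `W + X + (κ₃ − Y)`, each direct, pairwise disjoint, with union `A ∖ {x₀}`:
`∑_A χ = χ(κ₁)χ(−W)χ(X)χ(Y) + χ(κ₂)χ(W)χ(−X)χ(Y) + χ(κ₃)χ(W)χ(X)χ(−Y) + χ(x₀)`. [folklore] -/
theorem cube_form_charsum {R : Type*} [CommRing R] (χ : A → R) (hmul : ∀ a b, χ (a + b) = χ a * χ b)
    {W X Y : Finset A} {κ₁ κ₂ κ₃ x₀ : A}
    (i₁ : Set.InjOn (fun p : A × A × A => p.1 + p.2.1 + p.2.2) ↑((W.image fun w => κ₁ - w) ×ˢ X ×ˢ Y))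
    (i₂ : Set.InjOn (fun p : A × A × A => p.1 + p.2.1 + p.2.2) ↑(W ×ˢ (X.image fun x => κ₂ - x) ×ˢ Y))
    (i₃ : Set.InjOn (fun p : A × A × A => p.1 + p.2.1 + p.2.2) ↑(W ×ˢ X ×ˢ (Y.image fun y => κ₃ - y)))
    (d₁₂ : Disjoint (((W.image fun w => κ₁ - w) ×ˢ X ×ˢ Y).image fun p : A × A × A => p.1 + p.2.1 + p.2.2)
      ((W ×ˢ (X.image fun x => κ₂ - x) ×ˢ Y).image fun p : A × A × A => p.1 + p.2.1 + p.2.2))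
    (d₁₃ : Disjoint (((W.image fun w => κ₁ - w) ×ˢ X ×ˢ Y).image fun p : A × A × A => p.1 + p.2.1 + p.2.2)
      ((W ×ˢ X ×ˢ (Y.image fun y => κ₃ - y)).image fun p : A × A × A => p.1 + p.2.1 + p.2.2))
    (d₂₃ : Disjoint ((W ×ˢ (X.image fun x => κ₂ - x) ×ˢ Y).image fun p : A × A × A => p.1 + p.2.1 + p.2.2)
      ((W ×ˢ X ×ˢ (Y.image fun y => κ₃ - y)).image fun p : A × A × A => p.1 + p.2.1 + p.2.2))
    (hcover : (((W.image fun w => κ₁ - w) ×ˢ X ×ˢ Y).image fun p : A × A × A => p.1 + p.2.1 + p.2.2) ∪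
      ((W ×ˢ (X.image fun x => κ₂ - x) ×ˢ Y).image fun p : A × A × A => p.1 + p.2.1 + p.2.2) ∪
      ((W ×ˢ X ×ˢ (Y.image fun y => κ₃ - y)).image fun p : A × A × A => p.1 + p.2.1 + p.2.2) = univ.erase x₀) :
    ∑ a, χ a = χ κ₁ * (∑ w ∈ W, χ (-w)) * (∑ x ∈ X, χ x) * (∑ y ∈ Y, χ y) +
      χ κ₂ * (∑ w ∈ W, χ w) * (∑ x ∈ X, χ (-x)) * (∑ y ∈ Y, χ y) +
      χ κ₃ * (∑ w ∈ W, χ w) * (∑ x ∈ X, χ x) * (∑ y ∈ Y, χ (-y)) + χ x₀ := by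
  have hsplit : ∑ a, χ a = (∑ a ∈ univ.erase x₀, χ a) + χ x₀ :=
    (sum_erase_add _ _ (mem_univ x₀)).symm
  rw [hsplit, ← hcover, sum_union (disjoint_union_left.2 ⟨d₁₃, d₂₃⟩), sum_union d₁₂]
  -- a generic box sum
  have box : ∀ (P Q' R' : Finset A), Set.InjOn (fun p : A × A × A => p.1 + p.2.1 + p.2.2) ↑(P ×ˢ Q' ×ˢ R') →
      ∑ a ∈ (P ×ˢ Q' ×ˢ R').image (fun p : A × A × A => p.1 + p.2.1 + p.2.2), χ a =
        (∑ u ∈ P, χ u) * (∑ v ∈ Q', χ v) * (∑ z ∈ R', χ z) := by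
    intro P Q' R' hinj
    rw [sum_image hinj, Finset.sum_product, Finset.sum_mul_sum, Finset.sum_mul]
    refine sum_congr rfl fun u _ => ?_
    rw [Finset.sum_product, Finset.sum_mul_sum]
    refine sum_congr rfl fun v _ => sum_congr rfl fun z _ => ?_
    show χ (u + v + z) = χ u * χ v * χ z
    rw [hmul, hmul]
  have refl : ∀ (Z : Finset A) (κ : A), ∑ u ∈ Z.image (fun z => κ - z), χ u = χ κ * ∑ z ∈ Z, χ (-z) := by
    intro Z κ
    rw [sum_image (by intro z _ z' _ h; simpa using h), mul_sum]
    refine sum_congr rfl fun z _ => ?_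
    show χ (κ - z) = χ κ * χ (-z)
    rw [sub_eq_add_neg, hmul]
  rw [box _ _ _ i₁, box _ _ _ i₂, box _ _ _ i₃, refl W κ₁, refl X κ₂, refl Y κ₃]
  ring

end CharSum

/-! ## The three-set shifted form of a cube law triple (any parity, any `c₀`) -/

section Form

variable {A : Type} [AddCommGroup A] [DecidableEq A] [Fintype A] {G : Type} [Group G] [DecidableEq G]
  {ρ τ : A → G} {c₀ : A} {S T U : Finset G}

/-- **Three-set shifted form.**  A cube law triple gives `W, X, Y` (the `ρ`-parts), shifts `κ₁, κ₂, κ₃` and a point `x₀`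
with `(κ₁ − W) + X + Y`, `W + (κ₂ − X) + Y`, `W + X + (κ₃ − Y)` direct, pairwise disjoint, of union `A ∖ {x₀}`. [folklore] -/
theorem cube_shifted_form_of_law
    (hρρ : ∀ a b, ρ a * ρ b = ρ (a + b)) (hρτ : ∀ a b, ρ a * τ b = τ (b - a))
    (hτρ : ∀ a b, τ a * ρ b = τ (a + b)) (hττ : ∀ a b, τ a * τ b = ρ (c₀ + b - a))
    (hρ : Function.Injective ρ) (hτ : Function.Injective τ) (hne : ∀ a b, ρ a ≠ τ b)
    (hsurj : ∀ g, (∃ a, ρ a = g) ∨ (∃ a, τ a = g))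
    (h : TripleProductProperty S T U)
    (hS : (univ.filter fun a : A => ρ a ∈ S).card = (univ.filter fun a : A => τ a ∈ S).card)
    (hT : (univ.filter fun a : A => ρ a ∈ T).card = (univ.filter fun a : A => τ a ∈ T).card)
    (hU : (univ.filter fun a : A => ρ a ∈ U).card = (univ.filter fun a : A => τ a ∈ U).card)
    (hV : 3 * (S.card * T.card * U.card) + 8 = 8 * Fintype.card A) :
    ∃ (W X Y : Finset A) (κ₁ κ₂ κ₃ x₀ : A), W.card = (univ.filter fun a : A => ρ a ∈ S).card ∧
      X.card = (univ.filter fun a : A => ρ a ∈ T).card ∧ Y.card = (univ.filter fun a : A => ρ a ∈ U).card ∧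
      3 * (W.card * X.card * Y.card) + 1 = Fintype.card A ∧
      Set.InjOn (fun p : A × A × A => p.1 + p.2.1 + p.2.2) ↑((W.image fun w => κ₁ - w) ×ˢ X ×ˢ Y) ∧
      Set.InjOn (fun p : A × A × A => p.1 + p.2.1 + p.2.2) ↑(W ×ˢ (X.image fun x => κ₂ - x) ×ˢ Y) ∧
      Set.InjOn (fun p : A × A × A => p.1 + p.2.1 + p.2.2) ↑(W ×ˢ X ×ˢ (Y.image fun y => κ₃ - y)) ∧
      Disjoint (((W.image fun w => κ₁ - w) ×ˢ X ×ˢ Y).image fun p : A × A × A => p.1 + p.2.1 + p.2.2)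
        ((W ×ˢ (X.image fun x => κ₂ - x) ×ˢ Y).image fun p : A × A × A => p.1 + p.2.1 + p.2.2) ∧
      Disjoint (((W.image fun w => κ₁ - w) ×ˢ X ×ˢ Y).image fun p : A × A × A => p.1 + p.2.1 + p.2.2)
        ((W ×ˢ X ×ˢ (Y.image fun y => κ₃ - y)).image fun p : A × A × A => p.1 + p.2.1 + p.2.2) ∧
      Disjoint ((W ×ˢ (X.image fun x => κ₂ - x) ×ˢ Y).image fun p : A × A × A => p.1 + p.2.1 + p.2.2)
        ((W ×ˢ X ×ˢ (Y.image fun y => κ₃ - y)).image fun p : A × A × A => p.1 + p.2.1 + p.2.2) ∧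
      (((W.image fun w => κ₁ - w) ×ˢ X ×ˢ Y).image fun p : A × A × A => p.1 + p.2.1 + p.2.2) ∪
        ((W ×ˢ (X.image fun x => κ₂ - x) ×ˢ Y).image fun p : A × A × A => p.1 + p.2.1 + p.2.2) ∪
        ((W ×ˢ X ×ˢ (Y.image fun y => κ₃ - y)).image fun p : A × A × A => p.1 + p.2.1 + p.2.2) = univ.erase x₀ := by
  set S₀ : Finset A := univ.filter fun a => ρ a ∈ S with hS₀
  set S₁ : Finset A := univ.filter fun a => τ a ∈ S with hS₁
  set T₀ : Finset A := univ.filter fun a => ρ a ∈ T with hT₀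
  set T₁ : Finset A := univ.filter fun a => τ a ∈ T with hT₁
  set U₀ : Finset A := univ.filter fun a => ρ a ∈ U with hU₀
  set U₁ : Finset A := univ.filter fun a => τ a ∈ U with hU₁
  obtain ⟨-, κS, κT, κU, hκS, hκT, hκU⟩ :=
    cube_structure_of_law_any hρρ hρτ hτρ hττ hρ hτ hne hsurj h hS hT hU hV
  have mS₀ : ∀ a ∈ S₀, ρ a ∈ S := fun a ha => by simpa [hS₀] using ha
  have mS₁ : ∀ a ∈ S₁, τ a ∈ S := fun a ha => by simpa [hS₁] using ha
  have mT₀ : ∀ a ∈ T₀, ρ a ∈ T := fun a ha => by simpa [hT₀] using ha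
  have mT₁ : ∀ a ∈ T₁, τ a ∈ T := fun a ha => by simpa [hT₁] using ha
  have mU₀ : ∀ a ∈ U₀, ρ a ∈ U := fun a ha => by simpa [hU₀] using ha
  have mU₁ : ∀ a ∈ U₁, τ a ∈ U := fun a ha => by simpa [hU₁] using ha
  have mS₀c : ∀ a ∈ S₀, cond false (τ a) (ρ a) ∈ S := fun a ha => by simpa using mS₀ a ha
  have mS₁c : ∀ a ∈ S₁, cond true (τ a) (ρ a) ∈ S := fun a ha => by simpa using mS₁ a ha
  have mT₀c : ∀ a ∈ T₀, cond false (τ a) (ρ a) ∈ T := fun a ha => by simpa using mT₀ a ha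
  have mT₁c : ∀ a ∈ T₁, cond true (τ a) (ρ a) ∈ T := fun a ha => by simpa using mT₁ a ha
  have mU₀c : ∀ a ∈ U₀, cond false (τ a) (ρ a) ∈ U := fun a ha => by simpa using mU₀ a ha
  have mU₁c : ∀ a ∈ U₁, cond true (τ a) (ρ a) ∈ U := fun a ha => by simpa using mU₁ a ha
  -- numerics
  have cS := card_eq_parts' hρ hτ hne hsurj S
  have cT := card_eq_parts' hρ hτ hne hsurj T
  have cU := card_eq_parts' hρ hτ hne hsurj U
  have hprod : S.card * T.card * U.card = 8 * (S₀.card * T₀.card * U₀.card) := by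
    rw [cS, cT, cU, ← hS, ← hT, ← hU]; ring
  rw [hprod] at hV
  have hn : S₀.card * T₀.card * U₀.card + S₀.card * T₀.card * U₀.card + S₀.card * T₀.card * U₀.card + 1 =
      Fintype.card A := by omega
  -- boxes
  have cs := card_sumset' hρρ hττ hρ hτ h
  have inj := sum_injOn' hρρ hττ hρ hτ h
  have iB1 := inj true false false mS₁c mT₀c mU₀c
  have iB2 := inj false true false mS₀c mT₁c mU₀c
  have iB3 := inj false false true mS₀c mT₀c mU₁c
  have d₁ := disjoint_sumset₁' hρρ hρτ hτρ hττ hne h false mS₁ mT₀ mU₀c mS₀ mT₁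
  have d₂ := disjoint_sumset₂' hρρ hρτ hτρ hττ hne h false mS₀c mT₁ mU₀ mS₀c mT₀ mU₁
  have d₃ := disjoint_sumset₃' hρρ hρτ hτρ hττ hne h false mS₀ mT₀c mU₁ mS₁ mU₀
  obtain ⟨x₁, hx₁⟩ := exists_missed_point d₁ d₃.symm d₂
    (by rw [cs true false false mS₁c mT₀c mU₀c, cs false true false mS₀c mT₁c mU₀c, cs false false true mS₀c mT₀c mU₁c,
          ← hS, ← hT, ← hU]; exact hn)
  have hcov : ((S₁ ×ˢ T₀ ×ˢ U₀).image (fun p : A × A × A => p.1 + p.2.1 + p.2.2)) ∪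
      ((S₀ ×ˢ T₁ ×ˢ U₀).image (fun p : A × A × A => p.1 + p.2.1 + p.2.2)) ∪
      ((S₀ ×ˢ T₀ ×ˢ U₁).image (fun p : A × A × A => p.1 + p.2.1 + p.2.2)) = univ.erase x₁ := by
    ext a
    have ha := congrArg (fun s : Finset A => a ∈ s) hx₁
    simp only [mem_sdiff, mem_univ, true_and, mem_singleton, eq_iff_iff] at ha
    simp only [mem_erase, mem_univ, and_true]
    tauto
  have hκS1 : S₁ = S₀.image (fun w => κS - w) := hκS
  have hκT1 : T₁ = T₀.image (fun t => κT - t) := hκT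
  have hκU1 : U₁ = U₀.image (fun u => κU - u) := hκU
  rw [hκS1] at iB1 d₁ d₃ hcov
  rw [hκT1] at iB2 d₁ d₂ hcov
  rw [hκU1] at iB3 d₂ d₃ hcov
  exact ⟨S₀, T₀, U₀, κS, κT, κU, x₁, rfl, rfl, rfl, by omega, iB1, iB2, iB3, d₁, d₃.symm, d₂, hcov⟩

end Form


end Summit.MatrixMultiplication.OmegaCensus
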